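import Summits.RiemannHypothesis.RiemannHypothesis.Theorems.TiltedLandingLaw421R2Ready

/-! # W-08 round 3 — HURWITZ'S SMALLEST COUNT: two critical points in a zero-free real interval force an NL event («tilt»)
(C1 «words / typing / kernel» rh-idea-5 g24, WORDS-54 §1/§5 item `nlEvent_of_two_crit`; SUPPORT for STUB 1
`RhW08.SealSwap.RestSuccBot` = «succession or tilt» of the round-3 line `Lines/trkD_v3bot.lean`; no frame, no engine data.)

The smallest case of Hurwitz's interval count `2K = N(g′) − N(g) − ½[sg(gg′)(a) − sg(gg′)(b)]` (Hurwitz 1912; Ki–Kim, Duke Math. J.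
104 (2000) p. 54 eq. (3.1)): if a real `C²` function `g` has NO zero on `[c₁, c₂]` and `g′` vanishes at `c₁ < c₂`, then some
`c ∈ [c₁, c₂]` is a CRITICAL ZERO of `g′` in Pólya's sense — `g′ c = 0`, `g c ≠ 0`, `g c · g″ c ≥ 0` — i.e. the tree's `NLEventOf`.
Proof: `φ := g · g′` vanishes at `c₁, c₂` and `φ′ = g′² + g g″` equals `g g″` at critical points; a differentiable real `φ` with two
zeros has a zero with non-negative derivative (the last non-positive point before a point where `φ > 0`, or `c₂` itself).
Specialised to `g = Re ∘ f⁽ᵏ⁾ ∘ (↑)` this gives `NLEventOf f k c`, and inside the LAW's range `|x − x₀| < (k+3)R/2` it fires `TiltReady`.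
This is the «K ≥ 1» half of LEMMA CL of the SUCC-OR-TILT memo (two real critical points of `f⁽ᵏ⁾` in one gap ⇒ a tilt is RECORDED).
Typed ≠ proved for the crux; RH is not proved. -/

namespace RhW08.Hurwitz

open Filter Topology Set
open RhIdea6.G17.W07C7 RhW08.StSwap

/-- (H0) REAL CORE. A differentiable `φ : ℝ → ℝ` vanishing at `c₁ < c₂` has a zero `c ∈ [c₁, c₂]` with `0 ≤ φ′ c`. -/
theorem exists_zero_deriv_nonneg {φ : ℝ → ℝ} (hφ : Differentiable ℝ φ) {c₁ c₂ : ℝ} (hlt : c₁ < c₂)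
    (h1 : φ c₁ = 0) (h2 : φ c₂ = 0) : ∃ c ∈ Icc c₁ c₂, φ c = 0 ∧ 0 ≤ deriv φ c := by
  by_cases hpos : 0 ≤ deriv φ c₂
  · exact ⟨c₂, right_mem_Icc.mpr hlt.le, h2, hpos⟩
  push Not at hpos
  -- the slope of `φ` at `c₂` from the left tends to `φ′ c₂ < 0`, so `φ > 0` somewhere in `(c₁, c₂)`
  have htend : Tendsto (slope φ c₂) (𝓝[<] c₂) (𝓝 (deriv φ c₂)) :=
    (hasDerivAt_iff_tendsto_slope.mp (hφ c₂).hasDerivAt).mono_left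
      (nhdsWithin_mono _ fun x hx => ne_of_lt hx)
  obtain ⟨x₁, hx₁, hsl⟩ : ∃ x₁, x₁ ∈ Ioo c₁ c₂ ∧ slope φ c₂ x₁ < 0 := by
    have hev : ∀ᶠ x in 𝓝[<] c₂, x ∈ Ioo c₁ c₂ ∧ slope φ c₂ x < 0 := by
      filter_upwards [Ioo_mem_nhdsLT hlt, htend.eventually_lt_const hpos] with x hx hx' using ⟨hx, hx'⟩
    exact hev.exists
  have hφx₁ : 0 < φ x₁ := by
    rw [slope_def_field, h2, sub_zero] at hsl
    have hden : x₁ - c₂ < 0 := sub_neg.mpr hx₁.2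
    by_contra hle
    push Not at hle
    have : 0 ≤ φ x₁ / (x₁ - c₂) := div_nonneg_of_nonpos hle hden.le
    linarith
  -- the last point of `[c₁, x₁]` at which `φ ≤ 0`
  set S : Set ℝ := Icc c₁ x₁ ∩ {x | φ x ≤ 0} with hS
  have hSne : S.Nonempty := ⟨c₁, ⟨left_mem_Icc.mpr hx₁.1.le, h1.le⟩⟩
  have hSbdd : BddAbove S := ⟨x₁, fun x hx => hx.1.2⟩
  have hScl : IsClosed S := isClosed_Icc.inter (isClosed_le hφ.continuous continuous_const)
  set c := sSup S with hc
  have hcS : c ∈ S := hScl.csSup_mem hSne hSbdd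
  have hφc_le : φ c ≤ 0 := hcS.2
  have hcx₁ : c < x₁ := lt_of_le_of_ne hcS.1.2 fun h => by
    rw [h] at hφc_le
    exact absurd hφc_le (not_le.mpr hφx₁)
  have hafter : ∀ y, c < y → y ≤ x₁ → 0 < φ y := fun y hy hy' => by
    by_contra hle
    push Not at hle
    have hyS : y ∈ S := ⟨⟨le_trans hcS.1.1 hy.le, hy'⟩, hle⟩
    exact absurd (le_csSup hSbdd hyS) (not_le.mpr hy)
  have hφc : φ c = 0 := by
    refine le_antisymm hφc_le ?_
    have htc : Tendsto φ (𝓝[>] c) (𝓝 (φ c)) := (hφ c).continuousAt.continuousWithinAt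
    refine ge_of_tendsto htc ?_
    filter_upwards [Ioo_mem_nhdsGT hcx₁] with y hy using (hafter y hy.1 hy.2.le).le
  have htend' : Tendsto (slope φ c) (𝓝[>] c) (𝓝 (deriv φ c)) :=
    (hasDerivAt_iff_tendsto_slope.mp (hφ c).hasDerivAt).mono_left
      (nhdsWithin_mono _ fun x hx => ne_of_gt hx)
  have hge : 0 ≤ deriv φ c := by
    refine ge_of_tendsto htend' ?_
    filter_upwards [Ioo_mem_nhdsGT hcx₁] with y hy
    rw [slope_def_field, hφc, sub_zero]
    exact (div_pos (hafter y hy.1 hy.2.le) (sub_pos.mpr hy.1)).le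
  exact ⟨c, ⟨hcS.1.1, hcx₁.le.trans hx₁.2.le⟩, hφc, hge⟩

/-- (H1) HURWITZ'S SMALLEST COUNT, real form. `g : ℝ → ℝ` differentiable with differentiable derivative, zero-free on
`[c₁, c₂]`, `g′ c₁ = g′ c₂ = 0`, `c₁ < c₂` ⟹ some `c ∈ [c₁, c₂]` has `g′ c = 0`, `g c ≠ 0` and `0 ≤ g c · g″ c`
(a critical ZERO of `g′`: a non-negative local minimum or non-positive local maximum type, or an inflection critical point). -/
theorem exists_nl_of_two_crit {g : ℝ → ℝ} (hg : Differentiable ℝ g) (hg' : Differentiable ℝ (deriv g))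
    {c₁ c₂ : ℝ} (hlt : c₁ < c₂) (h1 : deriv g c₁ = 0) (h2 : deriv g c₂ = 0)
    (hnz : ∀ x ∈ Icc c₁ c₂, g x ≠ 0) :
    ∃ c ∈ Icc c₁ c₂, deriv g c = 0 ∧ g c ≠ 0 ∧ 0 ≤ g c * deriv (deriv g) c := by
  set φ : ℝ → ℝ := fun x => g x * deriv g x with hφ
  have hφd : Differentiable ℝ φ := hg.mul hg'
  have hφ' : ∀ x, deriv φ x = deriv g x * deriv g x + g x * deriv (deriv g) x := fun x => by
    rw [hφ]
    change deriv (g * deriv g) x = _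
    rw [deriv_mul (hg x) (hg' x)]
  obtain ⟨c, hc, hφc, hge⟩ :=
    exists_zero_deriv_nonneg hφd hlt (by simp [hφ, h1]) (by simp [hφ, h2])
  have hgc : g c ≠ 0 := hnz c hc
  have hdc : deriv g c = 0 := by
    have h0 : g c * deriv g c = 0 := hφc
    rcases mul_eq_zero.mp h0 with h | h
    · exact absurd h hgc
    · exact h
  refine ⟨c, hc, hdc, hgc, ?_⟩
  have h := hge
  rw [hφ' c, hdc, mul_zero, zero_add] at h
  exact h

/-- (H2) COMPLEX / ITERATED-DERIVATIVE FORM = the tree's `NLEventOf`. For `f` differentiable on ℂ and a level `k`: if the real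
parts of `f⁽ᵏ⁺¹⁾` vanish at real `c₁ < c₂` while the real part of `f⁽ᵏ⁾` has no zero on `[c₁, c₂]`, then `NLEventOf f k c` for
some `c ∈ [c₁, c₂]` (no realness hypothesis needed: `d/dx Re F(x) = Re F′(x)` along ℝ for any holomorphic `F`). -/
theorem nlEventOf_of_two_crit {f : ℂ → ℂ} (hf : Differentiable ℂ f) (k : ℕ) {c₁ c₂ : ℝ} (hlt : c₁ < c₂)
    (h1 : (iteratedDeriv (k + 1) f (c₁ : ℂ)).re = 0) (h2 : (iteratedDeriv (k + 1) f (c₂ : ℂ)).re = 0)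
    (hnz : ∀ x ∈ Icc c₁ c₂, (iteratedDeriv k f (x : ℂ)).re ≠ 0) :
    ∃ c ∈ Icc c₁ c₂, NLEventOf f k c := by
  have hdk : ∀ n : ℕ, Differentiable ℂ (iteratedDeriv n f) := fun n =>
    (hf.contDiff (n := ⊤)).differentiable_iteratedDeriv n (WithTop.coe_lt_top _)
  set g : ℝ → ℝ := fun t => (iteratedDeriv k f (t : ℂ)).re with hgdef
  have hg1 : ∀ t : ℝ, HasDerivAt g ((iteratedDeriv (k + 1) f (t : ℂ)).re) t := fun t => by
    have h := ((hdk k) (t : ℂ)).hasDerivAt.real_of_complex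
    rw [← iteratedDeriv_succ] at h
    exact h
  have hderiv_g : deriv g = fun t : ℝ => (iteratedDeriv (k + 1) f (t : ℂ)).re := funext fun t => (hg1 t).deriv
  have hg2 : ∀ t : ℝ, HasDerivAt (deriv g) ((iteratedDeriv (k + 2) f (t : ℂ)).re) t := fun t => by
    rw [hderiv_g]
    have h := ((hdk (k + 1)) (t : ℂ)).hasDerivAt.real_of_complex
    rw [← iteratedDeriv_succ] at h
    exact h
  have hgd : Differentiable ℝ g := fun t => (hg1 t).differentiableAt
  have hgd' : Differentiable ℝ (deriv g) := fun t => (hg2 t).differentiableAt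
  have hdd : deriv (deriv g) = fun t : ℝ => (iteratedDeriv (k + 2) f (t : ℂ)).re := funext fun t => (hg2 t).deriv
  have h1' : deriv g c₁ = 0 := by rw [hderiv_g]; exact h1
  have h2' : deriv g c₂ = 0 := by rw [hderiv_g]; exact h2
  obtain ⟨c, hc, hdc, hgc, hnl⟩ := exists_nl_of_two_crit hgd hgd' hlt h1' h2' hnz
  refine ⟨c, hc, ?_, hgc, ?_⟩
  · rw [hderiv_g] at hdc
    exact hdc
  · rw [hdd] at hnl
    exact hnl

/-- (H2′) the same with the hand's natural hypotheses: honest complex zeros of `f⁽ᵏ⁺¹⁾` at `c₁ < c₂`, `f⁽ᵏ⁾` real on ℝ and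
zero-free on `[c₁, c₂]`. -/
theorem nlEventOf_of_two_crit' {f : ℂ → ℂ} (hf : Differentiable ℂ f) (k : ℕ) {c₁ c₂ : ℝ} (hlt : c₁ < c₂)
    (h1 : iteratedDeriv (k + 1) f (c₁ : ℂ) = 0) (h2 : iteratedDeriv (k + 1) f (c₂ : ℂ) = 0)
    (hreal : ∀ x : ℝ, (iteratedDeriv k f (x : ℂ)).im = 0)
    (hnz : ∀ x ∈ Icc c₁ c₂, iteratedDeriv k f (x : ℂ) ≠ 0) :
    ∃ c ∈ Icc c₁ c₂, NLEventOf f k c := by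
  refine nlEventOf_of_two_crit hf k hlt (by rw [h1]; rfl) (by rw [h2]; rfl) fun x hx hre => ?_
  exact hnz x hx (Complex.ext (by simpa using hre) (by simpa using hreal x))

/-- (H3) … and inside the LAW's range the NL event is a `TiltReady` witness at level `k` (state-free: any `u`). -/
theorem tiltReady_of_two_crit {f : ℂ → ℂ} (hf : Differentiable ℂ f) (η x₀ s hmax R Hs : ℝ) (B k : ℕ) (u : ℂ)
    {c₁ c₂ : ℝ} (hlt : c₁ < c₂) (hr₁ : |c₁ - x₀| < ((k : ℝ) + 3) * R / 2) (hr₂ : |c₂ - x₀| < ((k : ℝ) + 3) * R / 2)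
    (h1 : (iteratedDeriv (k + 1) f (c₁ : ℂ)).re = 0) (h2 : (iteratedDeriv (k + 1) f (c₂ : ℂ)).re = 0)
    (hnz : ∀ x ∈ Icc c₁ c₂, (iteratedDeriv k f (x : ℂ)).re ≠ 0) :
    TiltReady η f x₀ s hmax R Hs B k u := by
  obtain ⟨c, hc, hnl⟩ := nlEventOf_of_two_crit hf k hlt h1 h2 hnz
  refine ⟨c, ?_, hnl⟩
  rw [abs_sub_lt_iff] at hr₁ hr₂ ⊢
  constructor <;> linarith [hc.1, hc.2]

/-- (H3′) … hence `ReadyR2` at level `k` (every state), by the tree's cumulative closure. -/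
theorem readyR2_of_two_crit {f : ℂ → ℂ} (hf : Differentiable ℂ f) (η x₀ s hmax R Hs : ℝ) (B k : ℕ) (u : ℂ)
    {c₁ c₂ : ℝ} (hlt : c₁ < c₂) (hr₁ : |c₁ - x₀| < ((k : ℝ) + 3) * R / 2) (hr₂ : |c₂ - x₀| < ((k : ℝ) + 3) * R / 2)
    (h1 : (iteratedDeriv (k + 1) f (c₁ : ℂ)).re = 0) (h2 : (iteratedDeriv (k + 1) f (c₂ : ℂ)).re = 0)
    (hnz : ∀ x ∈ Icc c₁ c₂, (iteratedDeriv k f (x : ℂ)).re ≠ 0) :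
    ReadyR2 η f x₀ s hmax R Hs B k u :=
  ⟨k, le_rfl, Or.inr (tiltReady_of_two_crit hf η x₀ s hmax R Hs B k u hlt hr₁ hr₂ h1 h2 hnz)⟩

end RhW08.Hurwitz
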